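import Mathlib
import Summits.KontsevichZagierPeriods.KontsevichZagierPeriods.Theorems.SoloInformedLegendreSectorTwo
import Summits.KontsevichZagierPeriods.KontsevichZagierPeriods.Theorems.SoloInformedLegendreWeierstrass
import HarnessLib
import HarnessLib.Audit

/-!
# SoloInformed — Legendre relation XVI: the CM lattice at `k₂ = √2 − 1` and THEOREM XXII

Solo-informed residency (s33), file XVI of the Legendre chain: the hypothesis of THEOREM XXI
(`AlgebraicIndependent ℚ ![K(√2−1), π]`, file XIV) is DISCHARGED from proved tree theorems,
making the discriminant-`−8` sector unconditional.

The dictionary Legendre ↔ Weierstrass at the singular modulus `k₂ = √2 − 1`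
(`k₂² = 3 − 2√2`, `k₂'² = 2√2 − 2`): the real cubic

  `4x³ − g₂x − g₃ = 4(x − e₁)(x − e₂)(x − e₃)`,  `e₁ = (2√2−1)/3 > e₂ = (5−4√2)/3 > e₃ = (2√2−4)/3`,
  `g₂ = (60 − 40√2)/3`,  `g₃ = (560 − 392√2)/27`  (algebraic, `g₂³ − 27g₃² = 64(99 − 70√2) > 0`)

has `e₁ − e₃ = 1`, `e₂ − e₃ = k₂²`, `e₁ − e₂ = k₂'²`. By the Uniformization Theorem
(`PeriodPair.uniformization_holds`) it is the cubic of a real lattice `Λ`; the real-period formula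
in Legendre form (file XV) gives `Ω₀ = 2K(k₂)`; the same for the rotated real lattice `iΛ` (cubic
`4x³ − g₂x + g₃`, largest root `−e₃`) gives `Ω₀' = 2K'(k₂)`; and COROLLARY XIX.2 OF THE CALCULUS
(`K' = √2·K`, Landen, file XI) gives `Ω₀' = √2·Ω₀`, whence `2√2·i·Λ ⊆ Λ` (`Λ ∩ ℝ = ℤΩ₀`,
`Λ ∩ iℝ = ℤiΩ₀'`): **`Λ` has complex multiplication** (by an order of `ℚ(√−2)`). Chudnovsky's CM
corollary (file XV) then yields

THEOREM (`soloInformed_algebraicIndependent_ellipticK_sqrtTwo_pi`): `K(√2−1)` and `π` are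
algebraically independent over `ℚ` — hence so are `K(√2−1)` and `E(√2−1)`;

THEOREM XXII (`soloInformed_kzp_on_hull_ellipticSqrtTwo_unconditional`): the Kontsevich–Zagier
period conjecture holds on the `K`-hull `K[⟦K(√2−1)⟧, ⟦E(√2−1)⟧] ⊂ P` (which contains `⟦π⟧`,
`⟦K'(√2−1)⟧`, `⟦E'(√2−1)⟧`) — unconditionally: the second decided CM elliptic sector, the first
with `K' ≠ K`.

References: G. V. Chudnovsky (1984) Ch. 7; D. Masser, LNM 437 (1975); D. F. Lawden (1989)
§§ 6.10–6.15; Borwein–Borwein, *Pi and the AGM* (1987) §§ 1.6, 4.5; this work (s33).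
-/

noncomputable section

open MeasureTheory Set Filter
open scoped Classical ComplexConjugate

open Literature.NumberTheory.Transcendental Literature.NumberTheory.Transcendental.KZ
open Literature.ModelTheory.ExponentialFields

namespace Summit.KontsevichZagierPeriods.KontsevichZagierPeriods.Theorems

/-! ### The CM lattice of discriminant `−8`: real period `2K(√2−1)`, multiplication by `2√−2` -/

/-- **The Weierstrass model of `K(√2 − 1)`.** There is a period pair `(ω₁, ω₂)` with
`g₂ = (60 − 40√2)/3`, `g₃ = (560 − 392√2)/27` (the cubic `4(x−e₁)(x−e₂)(x−e₃)`,
`e₁ = (2√2−1)/3`, `e₂ = (5−4√2)/3`, `e₃ = (2√2−4)/3`), whose lattice `Λ` satisfies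
`2√2·i·Λ ⊆ Λ` (complex multiplication by `2√−2`), and whose first period is
`ω₁ = Ω₀ = 2K(√2−1)`. Ingredients: Uniformization; the real-period formula for `Λ` (`Ω₀ = 2K`)
and for `iΛ` (`Ω₀' = 2K'`); COROLLARY XIX.2 of the calculus (`K' = √2K`, so `Ω₀' = √2Ω₀`);
`Λ ∩ ℝ = ℤΩ₀`, `Λ ∩ iℝ = ℤiΩ₀'`. [this work] -/
theorem soloInformed_exists_cm_periodPair_sqrtTwo (K : IntegralRep 1)
    (hKd : K.domain = {x : Fin 1 → ℝ | x 0 ∈ Ioo (0:ℝ) 1})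
    (hKi : EqOn K.integrand (fun x => (√(1 - x 0 ^ 2))⁻¹ *
      (√(1 - (√2 - 1) ^ 2 * x 0 ^ 2))⁻¹) K.domain) :
    ∃ L : PeriodPair, L.g₂ = (((60 - 40 * √2) / 3 : ℝ) : ℂ) ∧
      L.g₃ = (((560 - 392 * √2) / 27 : ℝ) : ℂ) ∧
      (∀ l ∈ L.lattice, ((2 * √2 : ℝ) : ℂ) * Complex.I * l ∈ L.lattice) ∧
      L.ω₁ = ((2 * K.value : ℝ) : ℂ) := by
  have hs2 : (√2 : ℝ) ^ 2 = 2 := Real.sq_sqrt (by norm_num)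
  have hs2p : (1:ℝ) < √2 := by
    rw [show (1:ℝ) = √1 from Real.sqrt_one.symm]
    exact Real.sqrt_lt_sqrt (by norm_num) (by norm_num)
  have hs2l : (√2 : ℝ) < 3 / 2 := by nlinarith [Real.sqrt_nonneg 2]
  -- the complementary representation `K'` and `K' = √2 K` (COROLLARY XIX.2)
  have hμ' : 1 - (√2 - 1) ^ 2 ∈ Ioo (0:ℝ) 1 := ⟨by nlinarith, by nlinarith⟩
  have h2 : IsAlgebraic ℚ (√2 : ℝ) := ⟨Polynomial.X ^ 2 - Polynomial.C 2,
    (Polynomial.monic_X_pow_sub_C (2 : ℚ) two_ne_zero).ne_zero, by simp [Real.sq_sqrt]⟩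
  have hμ'a : IsAlgebraic ℚ (1 - (√2 - 1) ^ 2 : ℝ) :=
    isAlgebraic_one.sub ((h2.sub isAlgebraic_one).pow 2)
  obtain ⟨K', hK'd, hK'i⟩ := soloInformed_exists_ellipticK_rep _ hμ' hμ'a
  have hKK' : K'.value = √2 * K.value :=
    soloInformed_ellipticK_sqrtTwoSubOne_complementary_value K K' hKd hKi hK'd (fun x _ => hK'i x)
  have hKv : K.value = ∫ s in Ioo (0:ℝ) 1, (√(1 - s ^ 2))⁻¹ * (√(1 - (√2 - 1) ^ 2 * s ^ 2))⁻¹ :=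
    soloInformed_value_eq_integral_Ioo K _ hKd hKi
  have hK'v : K'.value =
      ∫ s in Ioo (0:ℝ) 1, (√(1 - s ^ 2))⁻¹ * (√(1 - (1 - (√2 - 1) ^ 2) * s ^ 2))⁻¹ :=
    soloInformed_value_eq_integral_Ioo K' _ hK'd (fun x _ => hK'i x)
  -- the lattice, from the Uniformization Theorem
  have hdisc : ((60 - 40 * √2) / 3 : ℝ) ^ 3 - 27 * ((560 - 392 * √2) / 27) ^ 2 =
      64 * (99 - 70 * √2) := by
    linear_combination ((134336 - 64000 * √2) / 27) * hs2
  have hdisc0 : ((60 - 40 * √2) / 3 : ℝ) ^ 3 - 27 * ((560 - 392 * √2) / 27) ^ 2 ≠ 0 := by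
    rw [hdisc]
    have : 70 * √2 < 99 := by nlinarith [Real.sqrt_nonneg 2]
    positivity
  obtain ⟨L₀, h₂, h₃⟩ := PeriodPair.uniformization_holds (((60 - 40 * √2) / 3 : ℝ) : ℂ)
    (((560 - 392 * √2) / 27 : ℝ) : ℂ) (by exact_mod_cast hdisc0)
  have hreal : L₀.IsReal :=
    PeriodPair.isReal_of_g₂_g₃_real PeriodPair.uniformization_unique_holds (by simp [h₂])
      (by simp [h₃])
  -- real period of `Λ`: `Ω₀ = 2K`
  have hf : ∀ x, 4 * x ^ 3 - L₀.g₂.re * x - L₀.g₃.re =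
      4 * ((x - (2 * √2 - 1) / 3) * (x - (5 - 4 * √2) / 3) * (x - (2 * √2 - 4) / 3)) := by
    intro x
    rw [h₂, h₃, Complex.ofReal_re, Complex.ofReal_re]
    linear_combination ((16 / 3) * x + (240 - 64 * √2) / 27) * hs2
  have hΩ₀ : L₀.minRealPeriod / 2 = K.value := by
    rw [soloInformed_minRealPeriod_div_two_eq_of_roots hreal hf (by linarith) (by linarith)
      (by ring), hKv]
    refine setIntegral_congr_fun measurableSet_Ioo fun s _ ↦ ?_
    rw [show (5 - 4 * √2) / 3 - (2 * √2 - 4) / 3 = (√2 - 1) ^ 2 by linear_combination -hs2]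
  -- real period of `iΛ`: `Ω₀' = 2K'`
  set L₁ := L₀.mulLeft Complex.I Complex.I_ne_zero with hL₁
  have hreal₁ : L₁.IsReal := hreal.mulLeft_I
  have hf₁ : ∀ x, 4 * x ^ 3 - L₁.g₂.re * x - L₁.g₃.re =
      4 * ((x - (4 - 2 * √2) / 3) * (x - (4 * √2 - 5) / 3) * (x - (1 - 2 * √2) / 3)) := by
    intro x
    rw [hL₁, PeriodPair.g₂_mulLeft_I, PeriodPair.g₃_mulLeft_I, Complex.neg_re]
    linear_combination (-1 : ℝ) * hf (-x)
  have hΩ₁ : L₁.minRealPeriod / 2 = K'.value := by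
    rw [soloInformed_minRealPeriod_div_two_eq_of_roots hreal₁ hf₁ (by linarith) (by linarith)
      (by ring), hK'v]
    refine setIntegral_congr_fun measurableSet_Ioo fun s _ ↦ ?_
    rw [show (4 * √2 - 5) / 3 - (1 - 2 * √2) / 3 = 1 - (√2 - 1) ^ 2 by linear_combination hs2]
  -- complex multiplication by `2√2 i`
  have hΩ₁eq : L₁.minRealPeriod = √2 * L₀.minRealPeriod := by
    rw [show L₁.minRealPeriod = 2 * (√2 * K.value) by linarith,
      show L₀.minRealPeriod = 2 * K.value by linarith]
    ring
  have hΩ₀mem : (L₀.minRealPeriod : ℂ) ∈ L₀.lattice := hreal.minRealPeriod_mem_lattice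
  have hIΩ₁mem : Complex.I * (L₁.minRealPeriod : ℂ) ∈ L₀.lattice := by
    have h1 : (L₁.minRealPeriod : ℂ) ∈ L₁.lattice := hreal₁.minRealPeriod_mem_lattice
    rw [hL₁, PeriodPair.mem_mulLeft_lattice, Complex.inv_I, neg_mul] at h1
    exact neg_mem_iff.mp h1
  have hs2c : ((√2 : ℝ) : ℂ) ^ 2 = 2 := by exact_mod_cast hs2
  have hΩ₁c : (L₁.minRealPeriod : ℂ) = ((√2 : ℝ) : ℂ) * (L₀.minRealPeriod : ℂ) := by
    rw [hΩ₁eq]; push_cast; ring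
  have hcm : ∀ l ∈ L₀.lattice, ((2 * √2 : ℝ) : ℂ) * Complex.I * l ∈ L₀.lattice := by
    intro l hl
    have hconj : conj l ∈ L₀.lattice := hreal l hl
    have hre : ((2 * l.re : ℝ) : ℂ) ∈ L₀.lattice := by
      have := add_mem hl hconj
      rwa [Complex.add_conj] at this
    obtain ⟨k, hk⟩ := hreal.exists_eq_int_mul hre
    have him : ((-(2 * l.im) : ℝ) : ℂ) ∈ L₁.lattice := by
      rw [hL₁, PeriodPair.mem_mulLeft_lattice, Complex.inv_I]
      have := sub_mem hl hconj
      rw [Complex.sub_conj] at this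
      convert this using 1
      push_cast
      ring
    obtain ⟨k', hk'⟩ := hreal₁.exists_eq_int_mul him
    have h2l : (2:ℂ) * l = (k : ℂ) * (L₀.minRealPeriod : ℂ) -
        (k' : ℂ) * (L₁.minRealPeriod : ℂ) * Complex.I := by
      have e1 : (2:ℂ) * l = ((2 * l.re : ℝ) : ℂ) + ((2 * l.im : ℝ) : ℂ) * Complex.I := by
        rw [← Complex.add_conj, ← Complex.sub_conj]; ring
      rw [e1, hk, show (2 * l.im : ℝ) = -(k' * L₁.minRealPeriod) by linarith]
      push_cast
      ring
    have key : ((2 * √2 : ℝ) : ℂ) * Complex.I * l =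
        (k : ℂ) * (Complex.I * (L₁.minRealPeriod : ℂ)) +
          ((2 * k' : ℤ) : ℂ) * (L₀.minRealPeriod : ℂ) := by
      push_cast
      linear_combination ((√2 : ℝ) : ℂ) * Complex.I * h2l +
        ((k' : ℂ) * ((√2 : ℝ) : ℂ) - (k : ℂ) * Complex.I) * hΩ₁c +
        ((k' : ℂ) * (L₀.minRealPeriod : ℂ)) * hs2c -
        (((√2 : ℝ) : ℂ) * (k' : ℂ) * (L₁.minRealPeriod : ℂ)) * Complex.I_sq
    rw [key]
    refine add_mem ?_ ?_
    · rw [← zsmul_eq_mul]; exact zsmul_mem hIΩ₁mem k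
    · rw [← zsmul_eq_mul]; exact zsmul_mem hΩ₀mem (2 * k')
  -- rebase so that `ω₁ = Ω₀`
  obtain ⟨L, hL, hω₁⟩ := hreal.exists_lattice_eq_ω₁_eq
  refine ⟨L, by rw [PeriodPair.g₂_eq_of_lattice_eq hL, h₂],
    by rw [PeriodPair.g₃_eq_of_lattice_eq hL, h₃], fun l hl ↦ ?_, ?_⟩
  · rw [hL] at hl ⊢
    exact hcm l hl
  · rw [hω₁, show L₀.minRealPeriod = 2 * K.value by linarith]

/-- **The lattice has complex multiplication and algebraic invariants** (packaged for
Chudnovsky's corollary). [this work] -/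
theorem soloInformed_exists_hasCM_periodPair_sqrtTwo (K : IntegralRep 1)
    (hKd : K.domain = {x : Fin 1 → ℝ | x 0 ∈ Ioo (0:ℝ) 1})
    (hKi : EqOn K.integrand (fun x => (√(1 - x 0 ^ 2))⁻¹ *
      (√(1 - (√2 - 1) ^ 2 * x 0 ^ 2))⁻¹) K.domain) :
    ∃ L : PeriodPair, IsAlgebraic ℚ L.g₂ ∧ IsAlgebraic ℚ L.g₃ ∧ L.HasCM ∧
      L.ω₁ = ((2 * K.value : ℝ) : ℂ) := by
  obtain ⟨L, hg₂, hg₃, hcm, hω₁⟩ := soloInformed_exists_cm_periodPair_sqrtTwo K hKd hKi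
  have h2 : IsAlgebraic ℚ (√2 : ℝ) := ⟨Polynomial.X ^ 2 - Polynomial.C 2,
    (Polynomial.monic_X_pow_sub_C (2 : ℚ) two_ne_zero).ne_zero, by simp [Real.sq_sqrt]⟩
  have hQ2 : ∀ p q : ℚ, IsAlgebraic ℚ ((p : ℝ) + (q : ℝ) * √2) := fun p q ↦ by
    simpa using ((isAlgebraic_algebraMap (R := ℚ) (A := ℝ) p).add
      ((isAlgebraic_algebraMap (R := ℚ) (A := ℝ) q).mul h2))
  have hg₂r : IsAlgebraic ℚ ((60 - 40 * √2) / 3 : ℝ) := by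
    convert hQ2 20 (-40 / 3) using 1; push_cast; ring
  have hg₃r : IsAlgebraic ℚ ((560 - 392 * √2) / 27 : ℝ) := by
    convert hQ2 (560 / 27) (-392 / 27) using 1; push_cast; ring
  refine ⟨L, ?_, ?_, ⟨((2 * √2 : ℝ) : ℂ) * Complex.I, fun n hn ↦ ?_, hcm⟩, hω₁⟩
  · rw [hg₂]; simpa using hg₂r.algebraMap (A := ℂ)
  · rw [hg₃]; simpa using hg₃r.algebraMap (A := ℂ)
  · have h := congrArg Complex.im hn
    simp only [Complex.mul_im, Complex.ofReal_re, Complex.ofReal_im, Complex.I_re, Complex.I_im,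
      mul_zero, mul_one, Complex.intCast_im] at h
    nlinarith [Real.sqrt_pos.mpr (by norm_num : (0:ℝ) < 2)]

/-! ### THEOREM XXII: the discriminant-`−8` sector, unconditionally -/

/-- **`K(√2−1)` and `π` are algebraically independent over `ℚ`** (G. V. Chudnovsky). From the CM
lattice of discriminant `−8` (`soloInformed_exists_hasCM_periodPair_sqrtTwo`: algebraic
invariants, CM, `ω₁ = 2K(√2−1)`) and Chudnovsky's CM corollary
(`soloInformed_algebraicIndependent_pi_of_hasCM`).
[cite: Chudnovsky1984, Ch. 7 Cor. 2.3 and Thm 2.6 (pp. 307–309)] -/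
theorem soloInformed_algebraicIndependent_ellipticK_sqrtTwo_pi (K : IntegralRep 1)
    (hKd : K.domain = {x : Fin 1 → ℝ | x 0 ∈ Ioo (0:ℝ) 1})
    (hKi : EqOn K.integrand (fun x => (√(1 - x 0 ^ 2))⁻¹ *
      (√(1 - (√2 - 1) ^ 2 * x 0 ^ 2))⁻¹) K.domain) :
    AlgebraicIndependent ℚ ![K.value, Real.pi] := by
  obtain ⟨L, hg₂, hg₃, hCM, hω₁⟩ := soloInformed_exists_hasCM_periodPair_sqrtTwo K hKd hKi
  set F : IntermediateField ℚ ℂ :=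
    IntermediateField.adjoin ℚ ({(Real.pi : ℂ), (K.value : ℂ)} : Set ℂ) with hF
  have hKF : (K.value : ℂ) ∈ F := IntermediateField.subset_adjoin ℚ _ (by simp)
  have hω : L.ω₁ ∈ F := by
    rw [hω₁]; push_cast
    exact mul_mem (by exact_mod_cast F.natCast_mem 2) hKF
  have hind := soloInformed_algebraicIndependent_pi_of_hasCM hg₂ hg₃ hCM (K.value : ℂ) hω
  have hreal : AlgebraicIndependent ℚ ![Real.pi, K.value] :=
    algebraicIndependent_real_pair_of_complex hind
  set G : IntermediateField ℚ ℝ := IntermediateField.adjoin ℚ ({K.value, Real.pi} : Set ℝ)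
  exact soloInformed_algebraicIndependent_pair_transfer hreal
    ⟨1, one_pos, by rw [pow_one]; exact IntermediateField.subset_adjoin ℚ _ (by simp)⟩
    ⟨1, one_pos, by rw [pow_one]; exact IntermediateField.subset_adjoin ℚ _ (by simp)⟩

/-- **`K(√2−1)` and `E(√2−1)` are algebraically independent over `ℚ`**, unconditionally
(via `π = 4√2·EK − 4K²`, COROLLARY of XVII + XIX.2 + XX.2). [this work] -/
theorem soloInformed_algebraicIndependent_ellipticSqrtTwo_unconditional (K E : IntegralRep 1)
    (hKd : K.domain = {x : Fin 1 → ℝ | x 0 ∈ Ioo (0:ℝ) 1})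
    (hKi : EqOn K.integrand (fun x => (√(1 - x 0 ^ 2))⁻¹ *
      (√(1 - (√2 - 1) ^ 2 * x 0 ^ 2))⁻¹) K.domain)
    (hEd : E.domain = {x : Fin 1 → ℝ | x 0 ∈ Ioo (0:ℝ) 1})
    (hEi : EqOn E.integrand (fun x => (1 - (√2 - 1) ^ 2 * x 0 ^ 2) *
      ((√(1 - x 0 ^ 2))⁻¹ * (√(1 - (√2 - 1) ^ 2 * x 0 ^ 2))⁻¹)) E.domain) :
    AlgebraicIndependent ℚ ![K.value, E.value] :=
  soloInformed_algebraicIndependent_ellipticSqrtTwo K E hKd hKi hEd hEi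
    (soloInformed_algebraicIndependent_ellipticK_sqrtTwo_pi K hKd hKi)

/-- **THEOREM XXII (the CM elliptic sector of discriminant `−8` is decided, unconditionally).**
On the `K`-hull `K[⟦K(√2−1)⟧, ⟦E(√2−1)⟧] ⊂ P` (which contains `⟦π⟧`, `⟦K'(√2−1)⟧`,
`⟦E'(√2−1)⟧`) the Kontsevich–Zagier period conjecture holds: representations (any dimensions)
with classes in the hull and equal values are equivalent under the three rules. THEOREM XXI with
its hypothesis discharged by `soloInformed_algebraicIndependent_ellipticK_sqrtTwo_pi`.
[this work] -/
theorem soloInformed_kzp_on_hull_ellipticSqrtTwo_unconditional (K E : IntegralRep 1)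
    (hKd : K.domain = {x : Fin 1 → ℝ | x 0 ∈ Ioo (0:ℝ) 1})
    (hKi : EqOn K.integrand (fun x => (√(1 - x 0 ^ 2))⁻¹ *
      (√(1 - (√2 - 1) ^ 2 * x 0 ^ 2))⁻¹) K.domain)
    (hEd : E.domain = {x : Fin 1 → ℝ | x 0 ∈ Ioo (0:ℝ) 1})
    (hEi : EqOn E.integrand (fun x => (1 - (√2 - 1) ^ 2 * x 0 ^ 2) *
      ((√(1 - x 0 ^ 2))⁻¹ * (√(1 - (√2 - 1) ^ 2 * x 0 ^ 2))⁻¹)) E.domain)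
    {n m : ℕ} (r : IntegralRep n) (r' : IntegralRep m)
    (hr : toFormalPeriod (of r) ∈
      soloInformedAlgHull ![toFormalPeriod (of K), toFormalPeriod (of E)])
    (hr' : toFormalPeriod (of r') ∈
      soloInformedAlgHull ![toFormalPeriod (of K), toFormalPeriod (of E)])
    (hv : r.value = r'.value) : Equivalent r r' :=
  soloInformed_kzp_on_hull_ellipticSqrtTwo K E hKd hKi hEd hEi
    (soloInformed_algebraicIndependent_ellipticK_sqrtTwo_pi K hKd hKi) r r' hr hr' hv

/-- **THEOREM XXII with the representations discharged**: Legendre representations `K(√2−1)`,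
`E(√2−1)` on `(0,1)` exist, `⟦π⟧` lies in their hull, and KZP holds on the hull. [this work] -/
theorem soloInformed_kzp_on_hull_ellipticSqrtTwo_unconditional_exists :
    ∃ K E : IntegralRep 1, K.domain = {x : Fin 1 → ℝ | x 0 ∈ Ioo (0:ℝ) 1} ∧
      (∀ x, K.integrand x = (√(1 - x 0 ^ 2))⁻¹ * (√(1 - (√2 - 1) ^ 2 * x 0 ^ 2))⁻¹) ∧
      E.domain = {x : Fin 1 → ℝ | x 0 ∈ Ioo (0:ℝ) 1} ∧
      (∀ x, E.integrand x = (1 - (√2 - 1) ^ 2 * x 0 ^ 2) *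
        ((√(1 - x 0 ^ 2))⁻¹ * (√(1 - (√2 - 1) ^ 2 * x 0 ^ 2))⁻¹)) ∧
      toFormalPeriod (of KZ.piRep) ∈
        soloInformedAlgHull ![toFormalPeriod (of K), toFormalPeriod (of E)] ∧
      AlgebraicIndependent ℚ ![K.value, E.value] ∧
      (∀ {n m : ℕ} (r : IntegralRep n) (r' : IntegralRep m),
        toFormalPeriod (of r) ∈ soloInformedAlgHull ![toFormalPeriod (of K), toFormalPeriod (of E)] →
        toFormalPeriod (of r') ∈ soloInformedAlgHull ![toFormalPeriod (of K), toFormalPeriod (of E)] →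
        r.value = r'.value → Equivalent r r') := by
  obtain ⟨K, E, hKd, hKi, hEd, hEi, hpi, -⟩ := soloInformed_kzp_on_hull_ellipticSqrtTwo_exists
  exact ⟨K, E, hKd, hKi, hEd, hEi, hpi,
    soloInformed_algebraicIndependent_ellipticSqrtTwo_unconditional K E hKd (fun x _ => hKi x) hEd
      (fun x _ => hEi x),
    fun r r' hr hr' hv => soloInformed_kzp_on_hull_ellipticSqrtTwo_unconditional K E hKd
      (fun x _ => hKi x) hEd (fun x _ => hEi x) r r' hr hr' hv⟩

end Summit.KontsevichZagierPeriods.KontsevichZagierPeriods.Theorems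

end
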